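import Mathlib

/-!
# Residual operator of an action along a fixed divisor: invariants are first integrals
# (card G, lever (R)), and the terminal-leaf certificate `span {m, g}` principal

(crux stmt-ResolutionOfSingularities-15640 `WildQuotients.WildQuotientResolution`; research rung R-T /
R1a of `L/w45c/CHAIN.md` v6; res-L1-w45c-idea-1 round-4 card G «translation-split-base-first»,
first checkable step, items `residual_apply_invariant_eq_zero` (lever (R), ring form),
`natTrailingDegree_dvd_of_derivative_eq_zero` (curve form) and `span_pair_isPrincipal_of_dvd`
(terminal-leaf shape); typed and landed by res-type-035 (reserve volunteer; res-L1-w45c-tri-2 word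
«all three TRUE AS STATED», STATUS 2026-08-27T05:08:57Z). [OURS · L1 W4.5c] — NOT a statement of
any manuscript (Hironaka 2017 is consumed nowhere); replaces the role of no printed item. AI-written
Lean, kernel-checked; weaker than expert review.)

## Setting (lever (R), ring form)

`S` a commutative ring, `σ : S →+* S` an endomorphism, `m : S`, and a *residual operator* `D : S → S`
with `σ s - s = m * D s` for all `s` (i.e. the augmentation ideal `⟨σ s - s⟩` lies in `(m)`: the
divisor `F = V(m)` is pointwise fixed, `D = m⁻¹(σ - 1)`). `D` is passed as a bare function together
with that identity (def-free; no choice of quotients is made here). Results: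

* `residual_apply_invariant_eq_zero` — **invariants are first integrals of `D`**: `σ f = f ⇒ D f = 0`
  (`m` a non-zero-divisor);
* `residual_mul`, `residual_mul'`, `residual_add` — `D` is a `σ`-twisted derivation:
  `D (f h) = D f · σ h + f · D h = D f · h + σ f · D h`;
* `residual_mul_mod` — modulo `m` the twist disappears (`σ h ≡ h mod m`): the class of `D` satisfies
  the plain Leibniz rule in `S ⧸ (m)` — the *residual vector field* `θ_F` of card G;
* `residual_sub_mem_span_of_sub_mem_span` — if moreover `m ∣ D m` (e.g. `σ m - m ∈ (m²)`), `D`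
  descends to `S ⧸ (m)`: `f ≡ f' ⇒ D f ≡ D f' (mod m)`;
* `residual_apply_invariant_mod_eq_zero` — hence `θ_F(f̄) = 0` for every `σ`-invariant `f`.

## Curve form

Over an integral domain `k` of characteristic `p` (prime): a polynomial first integral `h` of a
non-zero vector field `c · d/dX` on the line (`c · h′ = 0`, `c ≠ 0`) has `h′ = 0`, hence is a
polynomial in `X ^ p` (`Polynomial.expand_contract`) and ALL its root multiplicities are divisible
by `p` (`Polynomial.rootMultiplicity_expand`): `rootMultiplicity_dvd_of_derivative_eq_zero`,
`natTrailingDegree_dvd_of_derivative_eq_zero` (the multiplicity at `0`),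
`rootMultiplicity_dvd_of_firstIntegral`, `eq_expand_of_derivative_eq_zero`. This is card G's «the
zero divisor of a decoration on a moving fixed divisor consists of `θ_F`-invariant curves and curves
of multiplicity `≡ 0 (mod p)`» in its one-variable kernel form. (res-L1-w45c-tri-2 TRIAGE v4 G2
narrows only the GEOMETRIC use of (R) — `θ_F(ḡ|_F) = 0` needs a `D`-flat decoration, cex `(J₂, g =
x₁)`; the ring/curve lemmas here carry no such claim.)

## Terminal leaf

`span_pair_isPrincipal_of_dvd` — `m ∣ g ∨ g ∣ m ⇒ (m, g)` principal: the shape in which card G's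
engine certifies a terminal leaf of the decorated game (`M` monomial, decoration monomial · unit,
exponents comparable).

No statement here depends on regularity, finiteness of the order of `σ`, or `p`-torsion hypotheses
beyond those displayed.
-/

-- single-problem summit: the doubled namespace component `ResolutionOfSingularities` is forced
set_option linter.dupNamespace false

open Polynomial

open scoped nonZeroDivisors

namespace Summit.ResolutionOfSingularities.ResolutionOfSingularities.Theorems.WildQuotientResolution.ResidualFirstIntegral

variable {S : Type*} [CommRing S]

/-! ### Lever (R), ring form: the residual operator `D = m⁻¹(σ - 1)` -/

/-- **Invariants are first integrals of the residual operator** (card G lever (R), ring form): if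
`σ s - s = m · D s` for all `s` with `m` a non-zero-divisor, then `σ f = f` forces `D f = 0`.
[OURS · W4.5c] -/
theorem residual_apply_invariant_eq_zero {σ : S →+* S} {m : S} (hm : m ∈ S⁰) {D : S → S}
    (hD : ∀ s, σ s - s = m * D s) {f : S} (hf : σ f = f) : D f = 0 := by
  have h : D f * m = 0 * m := by rw [zero_mul, mul_comm, ← hD, hf, sub_self]
  exact (mul_cancel_right_mem_nonZeroDivisors hm).mp h

/-- Twisted Leibniz rule, multiplied through by `m` (no hypothesis on `m`):
`m · D (f h) = m · (D f · σ h + f · D h)` — from `σ (f h) - f h = (σ f - f) σ h + f (σ h - h)`.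
[folklore] -/
theorem mul_residual_mul {σ : S →+* S} {m : S} {D : S → S}
    (hD : ∀ s, σ s - s = m * D s) (f h : S) :
    m * D (f * h) = m * (D f * σ h + f * D h) := by
  rw [← hD, mul_add, ← mul_assoc, ← hD, mul_left_comm, ← hD, map_mul]
  ring

/-- **`D` is a `σ`-twisted derivation** (convention: twist on the RIGHT factor's image):
`D (f h) = D f · σ h + f · D h`, for `m` a non-zero-divisor. [OURS · W4.5c] -/
theorem residual_mul {σ : S →+* S} {m : S} (hm : m ∈ S⁰) {D : S → S}
    (hD : ∀ s, σ s - s = m * D s) (f h : S) :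
    D (f * h) = D f * σ h + f * D h := by
  have e := mul_residual_mul hD f h
  rw [mul_comm m, mul_comm m] at e
  exact mul_cancel_right_mem_nonZeroDivisors hm |>.mp e

/-- The other convention of the twisted Leibniz rule: `D (f h) = D f · h + σ f · D h` (both hold,
since `σ = 1 + m D` and `S` is commutative). [OURS · W4.5c] -/
theorem residual_mul' {σ : S →+* S} {m : S} (hm : m ∈ S⁰) {D : S → S}
    (hD : ∀ s, σ s - s = m * D s) (f h : S) :
    D (f * h) = D f * h + σ f * D h := by
  rw [mul_comm f h, residual_mul hm hD h f]
  ring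

/-- `D` is additive (for `m` a non-zero-divisor). [folklore] -/
theorem residual_add {σ : S →+* S} {m : S} (hm : m ∈ S⁰) {D : S → S}
    (hD : ∀ s, σ s - s = m * D s) (f h : S) :
    D (f + h) = D f + D h := by
  have e : m * D (f + h) = m * (D f + D h) := by
    rw [← hD, mul_add, ← hD, ← hD, map_add]; ring
  rw [mul_comm m, mul_comm m] at e
  exact mul_cancel_right_mem_nonZeroDivisors hm |>.mp e

/-- `σ` is the identity modulo `m`: `σ h - h ∈ (m)` (the divisor `V(m)` is pointwise fixed).
[folklore] -/
theorem map_sub_self_mem_span {σ : S →+* S} {m : S} {D : S → S}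
    (hD : ∀ s, σ s - s = m * D s) (h : S) : σ h - h ∈ Ideal.span {m} := by
  rw [hD]
  exact Ideal.mul_mem_right _ _ (Ideal.mem_span_singleton_self m)

/-- **The residual vector field `θ_F`**: modulo `m` the twisted Leibniz rule becomes the plain one,
`[D (f h)] = [D f] · [h] + [f] · [D h]` in `S ⧸ (m)` — the class of `D` is a derivation along the
fixed divisor `F = V(m)` (with values in `S ⧸ (m)`; for descent of the argument see
`residual_sub_mem_span_of_sub_mem_span`). [OURS · W4.5c] -/
theorem residual_mul_mod {σ : S →+* S} {m : S} (hm : m ∈ S⁰) {D : S → S}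
    (hD : ∀ s, σ s - s = m * D s) (f h : S) :
    Ideal.Quotient.mk (Ideal.span {m}) (D (f * h))
      = Ideal.Quotient.mk (Ideal.span {m}) (D f) * Ideal.Quotient.mk (Ideal.span {m}) h
        + Ideal.Quotient.mk (Ideal.span {m}) f * Ideal.Quotient.mk (Ideal.span {m}) (D h) := by
  rw [residual_mul hm hD, map_add, map_mul, map_mul]
  congr 2
  exact (Ideal.Quotient.mk_eq_mk_iff_sub_mem _ _).mpr (map_sub_self_mem_span hD h)

/-- **Descent of `D` to the divisor**: if in addition `m ∣ D m` (equivalently `σ m - m ∈ (m²)`, as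
for an exceptional divisor `m = x`, `σ x = x / (1 + x)`), then `D` preserves congruence modulo `m`:
`f - f' ∈ (m) ⇒ D f - D f' ∈ (m)`. So `θ_F := D mod m` is a well-defined derivation of `S ⧸ (m)`.
[OURS · W4.5c] -/
theorem residual_sub_mem_span_of_sub_mem_span {σ : S →+* S} {m : S} (hm : m ∈ S⁰) {D : S → S}
    (hD : ∀ s, σ s - s = m * D s) (hDm : m ∣ D m) {f f' : S} (hff' : f - f' ∈ Ideal.span {m}) :
    D f - D f' ∈ Ideal.span {m} := by
  obtain ⟨t, ht⟩ := Ideal.mem_span_singleton'.mp hff'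
  have ef : f = f' + t * m := by rw [ht, add_sub_cancel]
  have e1 : D f = D f' + D (t * m) := by rw [ef, residual_add hm hD]
  rw [e1, add_sub_cancel_left, residual_mul hm hD]
  obtain ⟨u, hu⟩ := hDm
  refine Ideal.add_mem _ ?_ ?_
  · refine Ideal.mul_mem_left _ _ ?_
    have : σ m = m + m * D m := by rw [← hD, add_sub_cancel]
    rw [this]
    exact Ideal.add_mem _ (Ideal.mem_span_singleton_self m)
      (Ideal.mul_mem_right _ _ (Ideal.mem_span_singleton_self m))
  · rw [hu, ← mul_assoc]
    exact Ideal.mul_mem_right _ _ (Ideal.mul_mem_left _ _ (Ideal.mem_span_singleton_self m))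

/-- **`θ_F` kills the restriction of every invariant**: for `σ`-invariant `f`, the class of `D f`
in `S ⧸ (m)` is `0` (indeed `D f = 0` exactly, `residual_apply_invariant_eq_zero`). Card G reads
this as: the restriction `f̄|_F` of an invariant to a moving fixed divisor is a FIRST INTEGRAL of the
residual vector field. [OURS · W4.5c] -/
theorem residual_apply_invariant_mod_eq_zero {σ : S →+* S} {m : S} (hm : m ∈ S⁰) {D : S → S}
    (hD : ∀ s, σ s - s = m * D s) {f : S} (hf : σ f = f) :
    Ideal.Quotient.mk (Ideal.span {m}) (D f) = 0 := by
  rw [residual_apply_invariant_eq_zero hm hD hf, map_zero]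

/-! ### Lever (R), curve form: a first integral on a line is a polynomial in `X ^ p` -/

section Curve

variable {k : Type*} [CommRing k] [IsDomain k] (p : ℕ) [Fact p.Prime] [CharP k p]

/-- **Curve form of lever (R)**: over an integral domain of prime characteristic `p`, a polynomial
with `h′ = 0` has ALL root multiplicities divisible by `p` (it is `q (X ^ p)` by
`Polynomial.expand_contract`, and `rootMultiplicity a (q (X ^ p)) = p · rootMultiplicity (a ^ p) q`
by `Polynomial.rootMultiplicity_expand`). Card G: «curves of multiplicity `≡ 0 (mod p)`».
[OURS · W4.5c] -/
theorem rootMultiplicity_dvd_of_derivative_eq_zero {h : k[X]} (hh : derivative h = 0) (a : k) :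
    p ∣ h.rootMultiplicity a := by
  have hp : p ≠ 0 := (Fact.out : p.Prime).ne_zero
  rw [← expand_contract p hh hp, rootMultiplicity_expand]
  exact dvd_mul_right p _

/-- The card's named form `natTrailingDegree_dvd_of_derivative_eq_zero`: `h′ = 0 ⇒ p ∣` the order of
vanishing of `h` at `0` (`natTrailingDegree = rootMultiplicity 0`; for `h = 0` both sides read
`p ∣ 0`). [OURS · W4.5c] -/
theorem natTrailingDegree_dvd_of_derivative_eq_zero {h : k[X]} (hh : derivative h = 0) :
    p ∣ h.natTrailingDegree := by
  rw [← rootMultiplicity_eq_natTrailingDegree']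
  exact rootMultiplicity_dvd_of_derivative_eq_zero p hh 0

/-- A polynomial first integral of a non-zero vector field `c · d/dX` on the line over a domain has
zero derivative. [folklore] -/
theorem derivative_eq_zero_of_mul_derivative_eq_zero {c h : k[X]} (hc : c ≠ 0)
    (H : c * derivative h = 0) : derivative h = 0 :=
  (mul_eq_zero.mp H).resolve_left hc

/-- **First-integral rigidity on a line**: if `c · h′ = 0` with `c ≠ 0` (i.e. `h` is a first
integral of the vector field `c · d/dX`), then every root multiplicity of `h` is divisible by `p`.
[OURS · W4.5c] -/
theorem rootMultiplicity_dvd_of_firstIntegral {c h : k[X]} (hc : c ≠ 0)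
    (H : c * derivative h = 0) (a : k) : p ∣ h.rootMultiplicity a :=
  rootMultiplicity_dvd_of_derivative_eq_zero p
    (derivative_eq_zero_of_mul_derivative_eq_zero hc H) a

/-- `h′ = 0 ⇒ h` is a polynomial in `X ^ p` (`h = expand p q`, `q = contract p h`). [folklore;
`Polynomial.expand_contract`] -/
theorem eq_expand_of_derivative_eq_zero {h : k[X]} (hh : derivative h = 0) :
    ∃ q : k[X], h = expand k p q :=
  ⟨contract p h, (expand_contract p hh (Fact.out : p.Prime).ne_zero).symm⟩

end Curve

/-! ### Terminal-leaf certificate -/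

/-- **Terminal leaf of the decorated game** (card G: «the decorated ideal `(m, g)` over a terminal
base point is principal once `m ∣ g` or `g ∣ m`»): in any commutative ring, comparability under
divisibility makes `span {m, g}` principal. [OURS · W4.5c; folklore] -/
theorem span_pair_isPrincipal_of_dvd {m g : S} (h : m ∣ g ∨ g ∣ m) :
    (Ideal.span {m, g} : Ideal S).IsPrincipal := by
  rcases h with h | h
  · exact ⟨⟨m, by rw [Ideal.span_pair_eq_span_left_iff_dvd.mpr h, Ideal.submodule_span_eq]⟩⟩
  · exact ⟨⟨g, by rw [Ideal.span_pair_eq_span_right_iff_dvd.mpr h, Ideal.submodule_span_eq]⟩⟩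

/-- Generator form of the terminal-leaf certificate: `m ∣ g ⇒ span {m, g} = span {m}`. [folklore;
`Ideal.span_pair_eq_span_left_iff_dvd`] -/
theorem span_pair_eq_span_singleton_of_dvd {m g : S} (h : m ∣ g) :
    (Ideal.span {m, g} : Ideal S) = Ideal.span {m} :=
  Ideal.span_pair_eq_span_left_iff_dvd.mpr h

end Summit.ResolutionOfSingularities.ResolutionOfSingularities.Theorems.WildQuotientResolution.ResidualFirstIntegral
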